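import Mathlib.LinearAlgebra.FreeModule.PID
import Mathlib.LinearAlgebra.Matrix.NonsingularInverse
import Mathlib.LinearAlgebra.Matrix.Basis
import Mathlib.LinearAlgebra.Dimension.Constructions
import Mathlib.RingTheory.Localization.FractionRing
import Mathlib.RingTheory.Localization.Integer
import Mathlib.RingTheory.Ideal.Quotient.Basic
import HarnessLib

/-!
# Saturated lattices: a subspace of `Kᵐ` has a basis of integral vectors with independent reductions

Let `O` be a principal ideal domain with field of fractions `K` and let `W ⊆ Kᵐ` be a `K`-subspace.
The *lattice of integral vectors* `W ∩ Oᵐ` is saturated in `Oᵐ`, hence a direct summand: there is an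
`O`-basis `b` of `Oᵐ` and an injection `f : Fin n ↪ Fin m` such that the vectors `b (f i)` lie in
`W`, span `W` over `K` (`n = dim_K W`), and — being part of a basis of `Oᵐ` — have linearly
independent reductions modulo every maximal ideal of `O` (`exists_basis_embedding_span_eq`,
`linearIndependent_quotient_basis`, `exists_integral_basis_linearIndependent_quotient`). The proof
is the Smith normal form of `W ∩ Oᵐ ⊆ Oᵐ` (Mathlib `Submodule.smithNormalForm`): the diagonal
entries `aᵢ` are nonzero, and `aᵢ • bM (f i) ∈ W` forces `bM (f i) ∈ W`.

This is the algebra behind "a `K`-point of a Grassmannian extends over a discrete valuation ring"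
(valuative criterion), in the coordinates used for spreading out a linear subspace of `ℙᴺ_K`,
`K = k(B)` the function field of a smooth curve, to a family of linear subspaces over a
neighbourhood of a closed point of `B` (Tian–Zong 2014, proof of Prop. 7.2 / Kollár,
*Rational curves on algebraic varieties*, II.3.11–3.13: limits of lines are lines). [folklore]

## Design notes

Everything is phrased with `Fin m → O`, `Fin m → K` and the coordinatewise inclusion `toFrac`
(`(Algebra.linearMap O K).compLeft`); Mathlib has Smith normal forms over PIDs
(`Submodule.smithNormalForm`) and `Matrix.linearIndependent_cols_iff_isUnit`, on which the file
rests; it has no statement about saturation of `W ∩ Oᵐ` (searched: `saturat`, `IsSaturated` — only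
for monoids/subgroups).
-/

noncomputable section

namespace Literature.LinearAlgebra

open Module

variable (O : Type*) [CommRing O] (K : Type*) [Field K] [Algebra O K] {m : ℕ}

/-- The coordinatewise inclusion `Oᵐ → Kᵐ`. [folklore] -/
def toFrac : (Fin m → O) →ₗ[O] (Fin m → K) :=
  (Algebra.linearMap O K).compLeft (Fin m)

/-- `toFrac v j = v j` in `K`. [folklore] -/
@[simp]
theorem toFrac_apply (v : Fin m → O) (j : Fin m) : toFrac O K v j = algebraMap O K (v j) := rfl

variable {O K}

/-- The **lattice of integral vectors** `W ∩ Oᵐ` of a `K`-subspace `W ⊆ Kᵐ`, as an `O`-submodule of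
`Oᵐ`. [folklore] -/
def intLattice (W : Submodule K (Fin m → K)) : Submodule O (Fin m → O) :=
  (W.restrictScalars O).comap (toFrac O K)

/-- Membership in the lattice of integral vectors. [folklore] -/
theorem mem_intLattice {W : Submodule K (Fin m → K)} {v : Fin m → O} :
    v ∈ intLattice (O := O) W ↔ toFrac O K v ∈ W := Iff.rfl

variable [IsDomain O] [IsFractionRing O K]

/-- `toFrac` is injective (a domain embeds in its field of fractions). [folklore] -/
theorem toFrac_injective : Function.Injective (toFrac O K : (Fin m → O) → Fin m → K) := by
  intro v w h
  funext j
  exact IsFractionRing.injective O K (by simpa using congr_fun h j)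

/-- Clearing denominators of a vector of `Kᵐ`: `c • x = toFrac y` for some nonzero `c ∈ O`.
[folklore] -/
theorem exists_smul_eq_toFrac (x : Fin m → K) :
    ∃ (c : nonZeroDivisors O) (y : Fin m → O), (c : O) • x = toFrac O K y := by
  classical
  obtain ⟨c, hc⟩ := IsLocalization.exist_integer_multiples (nonZeroDivisors O) Finset.univ x
  choose! y hy using hc
  refine ⟨c, fun j => y j, funext fun j => ?_⟩
  rw [Pi.smul_apply, toFrac_apply, hy j (Finset.mem_univ j)]

variable [IsPrincipalIdealRing O]

/-- **Saturated sublattices are direct summands.** For a `K`-subspace `W ⊆ Kᵐ` over the field of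
fractions `K` of a principal ideal domain `O`, there are an `O`-basis `b` of `Oᵐ` and an injection
`f : Fin n ↪ Fin m` such that the basis vectors `b (f i)` lie in `W` and span `W` over `K` (Smith
normal form of `W ∩ Oᵐ ⊆ Oᵐ`; its diagonal entries are nonzero and `W` is a `K`-subspace, so the
basis vectors `bM (f i)` themselves lie in `W`). [folklore] -/
theorem exists_basis_embedding_span_eq (W : Submodule K (Fin m → K)) :
    ∃ (n : ℕ) (b : Basis (Fin m) O (Fin m → O)) (f : Fin n ↪ Fin m),
      (∀ i, toFrac O K (b (f i)) ∈ W) ∧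
        Submodule.span K (Set.range fun i => toFrac O K (b (f i))) = W := by
  classical
  obtain ⟨n, bM, bN, f, a, hsnf⟩ := Submodule.smithNormalForm (Pi.basisFun O (Fin m)) (intLattice W)
  -- the diagonal entries are nonzero
  have ha : ∀ i, a i ≠ 0 := by
    intro i h0
    apply bN.ne_zero i
    apply Subtype.ext
    rw [hsnf i, h0, zero_smul]
    simp
  -- the basis vectors lie in `W`
  have hmem : ∀ i, toFrac O K (bM (f i)) ∈ W := by
    intro i
    have h1 : toFrac O K ((bN i : Fin m → O)) ∈ W := (bN i).2
    rw [hsnf i, map_smul, Algebra.smul_def'] at h1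
    change algebraMap O K (a i) • toFrac O K (bM (f i)) ∈ W at h1
    have ha' : algebraMap O K (a i) ≠ 0 :=
      fun h => ha i (IsFractionRing.injective O K (by rw [h, map_zero]))
    rwa [W.smul_mem_iff ha'] at h1
  refine ⟨n, bM, f, hmem, le_antisymm (Submodule.span_le.2 ?_) fun x hx => ?_⟩
  · rintro _ ⟨i, rfl⟩
    exact hmem i
  · -- clear denominators and expand in the basis `bN` of `W ∩ Oᵐ`
    obtain ⟨c, y, hcy⟩ := exists_smul_eq_toFrac (O := O) (K := K) x
    have hy : y ∈ intLattice (O := O) W := by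
      rw [mem_intLattice, ← hcy]
      exact W.smul_of_tower_mem _ hx
    have hyrepr : y = ∑ i, (bN.repr ⟨y, hy⟩ i * a i) • bM (f i) := by
      have h := congr_arg (fun v : intLattice (O := O) W => (v : Fin m → O)) (bN.sum_repr ⟨y, hy⟩)
      simp only [Submodule.coe_sum, Submodule.coe_smul_of_tower] at h
      refine h.symm.trans (Finset.sum_congr rfl fun i _ => ?_)
      rw [hsnf i, smul_smul]
    have hc : algebraMap O K (c : O) ≠ 0 := IsFractionRing.to_map_ne_zero_of_mem_nonZeroDivisors c.2
    have hx' : x = (algebraMap O K (c : O))⁻¹ • toFrac O K y := by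
      rw [← hcy, ← algebraMap_smul K (c : O) x, smul_smul, inv_mul_cancel₀ hc, one_smul]
    rw [hx', hyrepr, map_sum]
    refine Submodule.smul_mem _ _ (Submodule.sum_mem _ fun i _ => ?_)
    rw [map_smul]
    exact Submodule.smul_of_tower_mem _ _ (Submodule.subset_span ⟨i, rfl⟩)

omit [IsPrincipalIdealRing O] in
/-- The vectors `toFrac (b (f i))` of a basis `b` of `Oᵐ` along an injection `f` are `K`-linearly
independent (clear denominators and use the independence of `b`). [folklore] -/
theorem linearIndependent_toFrac_basis (b : Basis (Fin m) O (Fin m → O)) {n : ℕ} (f : Fin n ↪ Fin m) :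
    LinearIndependent K fun i => toFrac O K (b (f i)) := by
  classical
  rw [Fintype.linearIndependent_iff]
  intro g hg i
  obtain ⟨c, e, hce⟩ := exists_smul_eq_toFrac (O := O) (K := K) (m := n) g
  have he : ∀ j, (c : O) • g j = algebraMap O K (e j) := fun j => by
    have := congr_fun hce j; simpa using this
  have hsum : toFrac O K (∑ j, e j • b (f j)) = 0 := by
    rw [map_sum]
    have : ∀ j, toFrac O K (e j • b (f j)) = ((c : O) • g j) • toFrac O K (b (f j)) := fun j => by
      rw [map_smul, he j, algebraMap_smul]
    simp_rw [this, smul_assoc, ← Finset.smul_sum, hg, smul_zero]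
  have hsum' : ∑ j, e j • b (f j) = 0 := toFrac_injective (by rw [hsum, map_zero])
  have hej : e i = 0 := by
    have hli := (b.linearIndependent.comp f f.injective)
    rw [Fintype.linearIndependent_iff] at hli
    exact hli e hsum' i
  have hc : algebraMap O K (c : O) ≠ 0 := IsFractionRing.to_map_ne_zero_of_mem_nonZeroDivisors c.2
  have h := he i
  rw [hej, map_zero, Algebra.smul_def, mul_eq_zero] at h
  exact h.resolve_left hc

omit [IsPrincipalIdealRing O] in
/-- In `exists_basis_embedding_span_eq`, the number of vectors is `dim_K W`. [folklore] -/
theorem finrank_eq_of_span_eq (b : Basis (Fin m) O (Fin m → O)) {n : ℕ} (f : Fin n ↪ Fin m)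
    {W : Submodule K (Fin m → K)}
    (hspan : Submodule.span K (Set.range fun i => toFrac O K (b (f i))) = W) :
    Module.finrank K W = n := by
  rw [← hspan, finrank_span_eq_card (linearIndependent_toFrac_basis b f), Fintype.card_fin]

omit [IsDomain O] [IsFractionRing O K] [IsPrincipalIdealRing O] in
/-- **Vectors of a basis of `Oᵐ` have linearly independent reductions** modulo any maximal ideal:
the matrix of the basis is invertible, so is its reduction, and the columns of an invertible matrix
over a field are linearly independent (`Matrix.linearIndependent_cols_iff_isUnit`). [folklore] -/
theorem linearIndependent_quotient_basis (b : Basis (Fin m) O (Fin m → O)) (I : Ideal O)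
    [I.IsMaximal] {n : ℕ} (f : Fin n ↪ Fin m) :
    LinearIndependent (O ⧸ I) fun i => fun j => Ideal.Quotient.mk I (b (f i) j) := by
  classical
  letI : Field (O ⧸ I) := Ideal.Quotient.field I
  have hAunit : IsUnit ((Pi.basisFun O (Fin m)).toMatrix b) :=
    (Matrix.isUnit_iff_isUnit_det _).2
      (Matrix.isUnit_det_of_right_inverse (Basis.toMatrix_mul_toMatrix_flip _ b))
  have hA' : IsUnit (((Pi.basisFun O (Fin m)).toMatrix b).map (Ideal.Quotient.mk I)) :=
    hAunit.map (Ideal.Quotient.mk I).mapMatrix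
  have hcols : LinearIndependent (O ⧸ I)
      (((Pi.basisFun O (Fin m)).toMatrix b).map (Ideal.Quotient.mk I)).col :=
    Matrix.linearIndependent_cols_iff_isUnit.2 hA'
  have hcol : (fun i => fun j => Ideal.Quotient.mk I (b (f i) j)) =
      (((Pi.basisFun O (Fin m)).toMatrix b).map (Ideal.Quotient.mk I)).col ∘ f := by
    funext i j
    rw [Function.comp_apply, Matrix.col_apply, Matrix.map_apply, Basis.toMatrix_apply,
      Pi.basisFun_repr]
  rw [hcol]
  exact hcols.comp f f.injective

/-- **Integral bases of a subspace with independent reductions.** For a `K`-subspace `W ⊆ Kᵐ`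
(`K` the field of fractions of a principal ideal domain `O`) there are `n = dim_K W` vectors
`w₁, …, w_n ∈ Oᵐ` lying in `W` and spanning it over `K` whose reductions modulo EVERY maximal ideal
`𝔪` of `O` are linearly independent over `O/𝔪`. [folklore] -/
theorem exists_integral_basis_linearIndependent_quotient (W : Submodule K (Fin m → K)) :
    ∃ (n : ℕ) (w : Fin n → Fin m → O), Module.finrank K W = n ∧ (∀ i, toFrac O K (w i) ∈ W) ∧
      Submodule.span K (Set.range fun i => toFrac O K (w i)) = W ∧
        ∀ (I : Ideal O) [I.IsMaximal],
          LinearIndependent (O ⧸ I) fun i => fun j => Ideal.Quotient.mk I (w i j) := by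
  obtain ⟨n, b, f, hmem, hspan⟩ := exists_basis_embedding_span_eq (O := O) W
  exact ⟨n, fun i => b (f i), finrank_eq_of_span_eq b f hspan, hmem, hspan,
    fun I _ => linearIndependent_quotient_basis b I f⟩

end Literature.LinearAlgebra

end
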